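import Summits.AtomisticToContinuum.FouriersLaw.Theses.ParityLiouvilleSeed

/-!
# Birth skeleton — crux `ParityLiouvilleSeed.UniformLinearRegime` (stmt-AtomisticToContinuum-13979)

BC3 birth certificate (LENSES-v3 §2, skeleton-register one-shot, 2026-08-17) for the rank-5 crux
`UniformLinearRegime` of route `route-AtomisticToContinuum-ParityLiouvilleSeed` (shared verbatim with
`route-AtomisticToContinuum-LogConcaveRigidity`): the N-UNIFORM LINEAR REGIME of the steady current,
`∀ ε > 0 ∃ δ₀ > 0 ∀ δ ∈ (0, δ₀) ∀ᶠ N, |J_N(δ)/δ − D_N| ≤ ε N` with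
`J_N(δ) = totalCurrent(μ N (T+δ/2) (T−δ/2))` and `D_N = lim_{δ→0} J_N(δ)/δ`.

THE LINE (the route header's own foreseen split "UniformLinearRegime ⇐ N-uniform bound on the second
δ-derivative of the current near equilibrium", TWO-LAYER PLAN): write `F_N(s) := J_N(s)`, the steady
total current as a function of the bias `s` at fixed mean temperature `T`. Under weak-NESS uniqueness
`F_N` is a well-defined function of the bias on the physical window `|s| < 2T`.

* `stub_responseDifferentiable` (S1, FIXED-`N` REGULARITY, size L, provable in principle with the
  tree's fixed-`N` machinery): for every `N` the map `s ↦ F_N(s)` is differentiable at every bias of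
  the physical window `|s| < 2T` — NESS expectations of the (polynomial, integrable) bond currents
  depend differentiably on the bath temperatures in the open quadrant (Rey-Bellet 2003 Rem. 4.4;
  Hairer–Majda 2009 Thm 2.3 framework; at `s = 0` this is the landed `FiniteResponseOfUnique` /
  `OddSectorIrreversibility.Corrector.openChainGreenKubo_holds`, whose uniform-in-`|δ|<δ₀` Harris
  mixing `pinnedChain_uniformMixing` is the engine; off equilibrium one perturbs around the NESS
  instead of the Gibbs state). Gives the DIFFERENTIAL CONDUCTANCE `F_N'(s) = deriv F_N s` a meaning.
* `stub_uniformResponseLipschitz` (S2, THE `N`-UNIFORM INPUT, open; all the crux's `N`-uniform content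
  sits here): the differential conductance has an `N`-UNIFORM LIPSCHITZ MODULUS AT ZERO BIAS at the
  extensive scale — `∃ δ₁ > 0, K ≥ 0, ∀ᶠ N, ∀ |ξ| < δ₁, |F_N'(ξ) − F_N'(0)| ≤ K·N·|ξ|`, i.e. the
  SECOND-ORDER response of the total current is at most extensive on a bias window that does not
  shrink with `N` (per bond: `|j̃_N'(ξ) − j̃_N'(0)| ≤ K|ξ|`; diffusive picture `F_N'(ξ) − F_N'(0) ≈
  κ‴-terms · ξ²`, odd symmetry `F_N(−s) = −F_N(s)` from `Theorems/BoundaryKubo/Negative/Reflection.lean`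
  makes `F_N'` even so the true modulus is `O(ξ²)`; ballistic member: `F_N` linear, `K = 0`). Fails
  exactly as the crux fails: a linear regime shrinking with `N` (bias-generated mean free path `~1/ξ`).
* COMPOSITION `UniformLinearRegime_of` (sorry-free, real analysis, `core_slope_bound`): continuity of
  `F_N` at `0` and the crux's own `Tendsto` hypothesis force `F_N(0) = 0` and `deriv F_N 0 = D_N`
  (uniqueness of limits on `𝓝[≠] 0`); the mean value theorem on `[0, δ]` gives `ξ ∈ (0, δ)` with
  `F_N(δ)/δ − D_N = F_N'(ξ) − F_N'(0)`, so `|F_N(δ)/δ − D_N| ≤ K N ξ ≤ K N δ ≤ ε N` once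
  `δ < δ₀ := min (min δ₁ T) (ε/(K+1))`.

WHY THIS CUT (not costume, not shredding). S2 speaks about the DERIVATIVE at NON-ZERO bias with an
`N`-uniform threshold (`∀ᶠ N` outside `∀ ξ`), the crux about chords at an `N`-threshold depending on
`δ`; S2 ⇒ crux needs S1 + MVT + limit identification, crux ⇏ S2. S1 alone is fixed-`N` and carries no
uniformity; S2 alone is inert without S1 (`deriv` of a non-differentiable function is junk `0`). Both
are load-bearing in `UniformLinearRegime_of`. Neither stub mentions `D`, `ε` or Fourier's law.

DISPROOF / NEGATIVES USED. `ledger crux ls stmt-AtomisticToContinuum-13979`: no `Disproof.lean`, no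
prior lines (first workfile of this crux). Refuter crux-attack evidence (UniformLinearRegimeEvidence.lean,
2026-08-15): modulo the route's fixed-bias rung the crux is equivalent to sublinear response and is
IMPLIED by `FouriersLaw`; the crux body HOLDS at `lam = β = 0` (defect exactly `0`). Consistently, S1
and S2 hold at the harmonic corner (`F_N` linear in the bias, `K = 0`): no anharmonicity is
load-bearing for THIS crux, so no `_false_without_` obstruction applies. `ledger negatives`: none of
the summit's refuted statements is about bias-regularity of the NESS current.

BC3 PROBES (folder `bc/`, 2026-08-17): `S1 → UniformLinearRegime`, `S1 → FouriersLaw`,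
`S2 → UniformLinearRegime`, `S2 → FouriersLaw` by `first | exact? | simpa using h | aesop` — all FAIL
(see NOTES.md `birth-certificate:` for rc and goals).
-/

noncomputable section

open MeasureTheory Set Filter Topology

namespace Summit.AtomisticToContinuum.FouriersLaw.Cruxes.UniformLinearRegime.Birth

open Literature.MathematicalPhysics.KineticTheory.HeatConduction
open Summit.AtomisticToContinuum.FouriersLaw.Theses.ParityLiouvilleSeed (UniformLinearRegime)

/-! ## Registered stubs (`sorry` only here) -/

/-- **S1 · `stub_responseDifferentiable`** (fixed-`N` regularity, size L). Under weak-NESS uniqueness,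
for every steady-state family `μ` of `pinnedChain ω₂ lam β γ` (all parameters `> 0`), every `T > 0`,
every `N` and every bias `δ` of the physical window `|δ| < 2T`, the steady total current
`s ↦ totalCurrent(μ N (T+s/2) (T−s/2))` is differentiable at `δ` (smooth dependence of the NESS
expectation of the polynomial currents on the bath temperatures in the open quadrant; at `δ = 0` the
derivative is the landed response coefficient `D_N`). [ReyBellet2003 Rem. 4.4; HairerMajda2009 Thm 2.3;
CuneoEckmannHairerReyBellet2018 Thm 2.13] -/
theorem stub_responseDifferentiable :
    ∀ ω₂ lam β γ : ℝ, 0 < ω₂ → 0 < lam → 0 < β → 0 < γ →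
    (∀ (N : ℕ) (T_L T_R : ℝ), 0 < T_L → 0 < T_R → ∀ μ ν : Measure (PhaseSpace N),
      (pinnedChain ω₂ lam β γ).IsSteadyState N T_L T_R μ →
      (pinnedChain ω₂ lam β γ).IsSteadyState N T_L T_R ν → μ = ν) →
    ∀ μ : (N : ℕ) → ℝ → ℝ → Measure (PhaseSpace N),
      (∀ (N : ℕ) (T_L T_R : ℝ), 0 < T_L → 0 < T_R →
        (pinnedChain ω₂ lam β γ).IsSteadyState N T_L T_R (μ N T_L T_R)) →
    ∀ T : ℝ, 0 < T →
    ∀ (N : ℕ) (δ : ℝ), |δ| < 2 * T →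
      DifferentiableAt ℝ (fun s : ℝ => (pinnedChain ω₂ lam β γ).totalCurrent (μ N (T + s / 2) (T - s / 2))) δ := by
  sorry

/-- **S2 · `stub_uniformResponseLipschitz`** (the `N`-uniform input; open, size XL). Under weak-NESS
uniqueness, for every steady-state family and every `T > 0` there are a bias window `δ₁ > 0` and a
constant `K ≥ 0`, both INDEPENDENT of `N`, such that for all sufficiently large `N` the differential
conductance `ξ ↦ deriv (s ↦ totalCurrent(μ N (T+s/2) (T−s/2))) ξ` satisfies
`|F_N'(ξ) − F_N'(0)| ≤ K · N · |ξ|` for `|ξ| < δ₁`: the second-order response of the total current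
near equilibrium is at most extensive on a window that does not shrink with `N` (per bond `O(|ξ|)`;
diffusive heuristics `O(ξ²/1)` per bond after the odd symmetry; ballistic member `K = 0`). Why it might
fail: the linear regime shrinks with `N` (conductance a function of `Nξ`, He–Ai–Chan–Hu 2010 NDTR
scaling) — exactly the failure mode of the crux. [doi:10.1103/physreve.81.041131; KunduDharNarayan2009;
BonettoLebowitzReyBellet2000 §5.2] -/
theorem stub_uniformResponseLipschitz :
    ∀ ω₂ lam β γ : ℝ, 0 < ω₂ → 0 < lam → 0 < β → 0 < γ →
    (∀ (N : ℕ) (T_L T_R : ℝ), 0 < T_L → 0 < T_R → ∀ μ ν : Measure (PhaseSpace N),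
      (pinnedChain ω₂ lam β γ).IsSteadyState N T_L T_R μ →
      (pinnedChain ω₂ lam β γ).IsSteadyState N T_L T_R ν → μ = ν) →
    ∀ μ : (N : ℕ) → ℝ → ℝ → Measure (PhaseSpace N),
      (∀ (N : ℕ) (T_L T_R : ℝ), 0 < T_L → 0 < T_R →
        (pinnedChain ω₂ lam β γ).IsSteadyState N T_L T_R (μ N T_L T_R)) →
    ∀ T : ℝ, 0 < T →
    ∃ δ₁ : ℝ, 0 < δ₁ ∧ ∃ K : ℝ, 0 ≤ K ∧ ∀ᶠ N : ℕ in atTop, ∀ ξ : ℝ, |ξ| < δ₁ →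
      |deriv (fun s : ℝ => (pinnedChain ω₂ lam β γ).totalCurrent (μ N (T + s / 2) (T - s / 2))) ξ
        - deriv (fun s : ℝ => (pinnedChain ω₂ lam β γ).totalCurrent (μ N (T + s / 2) (T - s / 2))) 0| ≤ K * (N : ℝ) * |ξ| := by
  sorry

/-! ## Name-keyed aliases of the two statements (VERBATIM the stub signatures; the skeleton audit
admits a `Prop` hypothesis of the composition only if its head constant carries a declared stub's name) -/
namespace Registered

/-- Verbatim statement of `stub_responseDifferentiable` (S1). -/
abbrev stub_responseDifferentiable : Prop :=
    ∀ ω₂ lam β γ : ℝ, 0 < ω₂ → 0 < lam → 0 < β → 0 < γ →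
    (∀ (N : ℕ) (T_L T_R : ℝ), 0 < T_L → 0 < T_R → ∀ μ ν : Measure (PhaseSpace N),
      (pinnedChain ω₂ lam β γ).IsSteadyState N T_L T_R μ →
      (pinnedChain ω₂ lam β γ).IsSteadyState N T_L T_R ν → μ = ν) →
    ∀ μ : (N : ℕ) → ℝ → ℝ → Measure (PhaseSpace N),
      (∀ (N : ℕ) (T_L T_R : ℝ), 0 < T_L → 0 < T_R →
        (pinnedChain ω₂ lam β γ).IsSteadyState N T_L T_R (μ N T_L T_R)) →
    ∀ T : ℝ, 0 < T →
    ∀ (N : ℕ) (δ : ℝ), |δ| < 2 * T →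
      DifferentiableAt ℝ (fun s : ℝ => (pinnedChain ω₂ lam β γ).totalCurrent (μ N (T + s / 2) (T - s / 2))) δ

/-- Verbatim statement of `stub_uniformResponseLipschitz` (S2). -/
abbrev stub_uniformResponseLipschitz : Prop :=
    ∀ ω₂ lam β γ : ℝ, 0 < ω₂ → 0 < lam → 0 < β → 0 < γ →
    (∀ (N : ℕ) (T_L T_R : ℝ), 0 < T_L → 0 < T_R → ∀ μ ν : Measure (PhaseSpace N),
      (pinnedChain ω₂ lam β γ).IsSteadyState N T_L T_R μ →
      (pinnedChain ω₂ lam β γ).IsSteadyState N T_L T_R ν → μ = ν) →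
    ∀ μ : (N : ℕ) → ℝ → ℝ → Measure (PhaseSpace N),
      (∀ (N : ℕ) (T_L T_R : ℝ), 0 < T_L → 0 < T_R →
        (pinnedChain ω₂ lam β γ).IsSteadyState N T_L T_R (μ N T_L T_R)) →
    ∀ T : ℝ, 0 < T →
    ∃ δ₁ : ℝ, 0 < δ₁ ∧ ∃ K : ℝ, 0 ≤ K ∧ ∀ᶠ N : ℕ in atTop, ∀ ξ : ℝ, |ξ| < δ₁ →
      |deriv (fun s : ℝ => (pinnedChain ω₂ lam β γ).totalCurrent (μ N (T + s / 2) (T - s / 2))) ξ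
        - deriv (fun s : ℝ => (pinnedChain ω₂ lam β γ).totalCurrent (μ N (T + s / 2) (T - s / 2))) 0| ≤ K * (N : ℝ) * |ξ|

end Registered

/-- The aliases ARE the stubs' statements (syntactic identity, checked by the kernel). -/
example : Registered.stub_responseDifferentiable ↔ type_of% stub_responseDifferentiable := Iff.rfl
example : Registered.stub_uniformResponseLipschitz ↔ type_of% stub_uniformResponseLipschitz := Iff.rfl

/-! ## The composition (sorry-free) -/

/-- Real-analysis core: if `F` is differentiable on `|s| < 2T`, `F(s)/s → D` as `s → 0` (`s ≠ 0`),
and `deriv F` has Lipschitz modulus `c` at `0` on `|ξ| < δ₁`, then for `0 < δ < min δ₁ (2T)` the chord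
slope is within `c·δ` of `D`: `F 0 = 0` and `deriv F 0 = D` by uniqueness of limits, then the mean
value theorem on `[0, δ]`. [folklore] -/
theorem core_slope_bound {F : ℝ → ℝ} {D c T δ₁ δ : ℝ}
    (hd : ∀ s : ℝ, |s| < 2 * T → DifferentiableAt ℝ F s)
    (hD : Tendsto (fun s : ℝ => F s / s) (𝓝[≠] 0) (𝓝 D))
    (hLip : ∀ ξ : ℝ, |ξ| < δ₁ → |deriv F ξ - deriv F 0| ≤ c * |ξ|)
    (hc : 0 ≤ c) (hδ : 0 < δ) (hδ₁ : δ < δ₁) (hδT : δ < 2 * T) :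
    |F δ / δ - D| ≤ c * δ := by
  have hT2 : (0 : ℝ) < 2 * T := lt_trans hδ hδT
  have hd0 : DifferentiableAt ℝ F 0 := hd 0 (by simpa using hT2)
  -- (1) `F 0 = 0`: continuity at `0` against `F s = (F s / s) * s → D * 0`.
  have hF0 : F 0 = 0 := by
    have h1 : Tendsto F (𝓝[≠] (0 : ℝ)) (𝓝 (F 0)) :=
      hd0.continuousAt.tendsto.mono_left nhdsWithin_le_nhds
    have hid : Tendsto (fun s : ℝ => s) (𝓝[≠] (0 : ℝ)) (𝓝 0) :=
      (continuous_id.tendsto (0 : ℝ)).mono_left nhdsWithin_le_nhds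
    have h2 : Tendsto (fun s : ℝ => F s / s * s) (𝓝[≠] (0 : ℝ)) (𝓝 (D * 0)) := hD.mul hid
    have heq : (fun s : ℝ => F s / s * s) =ᶠ[𝓝[≠] (0 : ℝ)] F := by
      filter_upwards [self_mem_nhdsWithin] with s hs
      exact div_mul_cancel₀ (F s) hs
    rw [mul_zero] at h2
    exact tendsto_nhds_unique h1 (h2.congr' heq)
  -- (2) `deriv F 0 = D`: the derivative is the limit of the same slopes.
  have hderiv0 : deriv F 0 = D := by
    have h := hd0.hasDerivAt
    rw [hasDerivAt_iff_tendsto_slope_zero] at h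
    have heq : (fun t : ℝ => t⁻¹ • (F (0 + t) - F 0)) = fun t => F t / t := by
      funext t
      rw [zero_add, hF0, sub_zero, smul_eq_mul, inv_mul_eq_div]
    rw [heq] at h
    exact tendsto_nhds_unique h hD
  -- (3) mean value theorem on `[0, δ]`.
  have hcont : ContinuousOn F (Icc 0 δ) := fun s hs =>
    (hd s (by rw [abs_of_nonneg hs.1]; linarith [hs.2])).continuousAt.continuousWithinAt
  have hdiff : DifferentiableOn ℝ F (Ioo 0 δ) := fun s hs =>
    (hd s (by rw [abs_of_pos hs.1]; linarith [hs.2])).differentiableWithinAt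
  obtain ⟨ξ, hξ, hξeq⟩ := exists_deriv_eq_slope F hδ hcont hdiff
  rw [hF0, sub_zero, sub_zero] at hξeq
  have hξabs : |ξ| < δ₁ := by rw [abs_of_pos hξ.1]; linarith [hξ.2]
  have hb := hLip ξ hξabs
  rw [hξeq, hderiv0, abs_of_pos hξ.1] at hb
  calc |F δ / δ - D| ≤ c * ξ := hb
    _ ≤ c * δ := mul_le_mul_of_nonneg_left hξ.2.le hc

/-- **`UniformLinearRegime_of`** — S1 → S2 → the crux (hypotheses = the `Registered.stub_*` aliases, definitionally the
stub signatures), concluded BY NAME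
(`Summit.AtomisticToContinuum.FouriersLaw.Theses.ParityLiouvilleSeed.UniformLinearRegime`). Given `ε`,
take `δ₁, K` from S2 and `δ₀ := min (min δ₁ T) (ε/(K+1))`; for `0 < δ < δ₀` and every `N` in S2's
eventual range, `core_slope_bound` (with S1 at that `N` and the crux's `Tendsto` hypothesis) gives
`|J_N(δ)/δ − D_N| ≤ K N δ ≤ ε N`. -/
theorem UniformLinearRegime_of (h1 : Registered.stub_responseDifferentiable)
    (h2 : Registered.stub_uniformResponseLipschitz) : UniformLinearRegime := by
  intro ω₂ lam β γ hω hl hβ hγ hU μ hμ T hT D hD ε hε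
  obtain ⟨δ₁, hδ₁, K, hK, hev⟩ := h2 ω₂ lam β γ hω hl hβ hγ hU μ hμ T hT
  have hK1 : 0 < K + 1 := by linarith
  refine ⟨min (min δ₁ T) (ε / (K + 1)), lt_min (lt_min hδ₁ hT) (div_pos hε hK1), fun δ hδ hδlt => ?_⟩
  have hδ₁' : δ < δ₁ := lt_of_lt_of_le hδlt ((min_le_left _ _).trans (min_le_left _ _))
  have hδT : δ < 2 * T := by
    have := lt_of_lt_of_le hδlt ((min_le_left _ _).trans (min_le_right _ _))
    linarith
  have hδε : δ < ε / (K + 1) := lt_of_lt_of_le hδlt (min_le_right _ _)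
  have hKδ : K * δ ≤ ε := by
    have h' : δ * (K + 1) < ε := (lt_div_iff₀ hK1).mp hδε
    nlinarith
  filter_upwards [hev] with N hN
  have hcore := core_slope_bound
    (F := fun s : ℝ => (pinnedChain ω₂ lam β γ).totalCurrent (μ N (T + s / 2) (T - s / 2)))
    (fun s hs => h1 ω₂ lam β γ hω hl hβ hγ hU μ hμ T hT N s hs) (hD N)
    (fun ξ hξ => hN ξ hξ) (by positivity : (0 : ℝ) ≤ K * (N : ℝ)) hδ hδ₁' hδT
  calc |(pinnedChain ω₂ lam β γ).totalCurrent (μ N (T + δ / 2) (T - δ / 2)) / δ - D N|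
        ≤ K * (N : ℝ) * δ := hcore
    _ = K * δ * (N : ℝ) := by ring
    _ ≤ ε * (N : ℝ) := mul_le_mul_of_nonneg_right hKδ (Nat.cast_nonneg N)

end Summit.AtomisticToContinuum.FouriersLaw.Cruxes.UniformLinearRegime.Birth
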